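import Literature.AnabelianGeometry.SemiGraphs.SpecialFibreTowerOfCoverings
import HarnessLib

/-!
# `Ex310TowerStatement` HOLDS at the special-fibre SELF-MODEL of every strictly coherent Thm-3.7 semi-graph of
# anabelioids ([SemiAnbd] Ex. 3.10 pp. 44–45 — instance form of F-3115 with GENUINE fibres)

Mochizuki, *Semi-graphs of anabelioids*, Publ. RIMS **42** (2006), §3, Example 3.10, manuscript p. 44 l. 9 – p. 45 l. 4
[cite: MochizukiSemiAnbd2006, Ex 3.10 p.44]; the origin-parametrised named statement `Ex310TowerStatement Ω`
(`TemperedSpecialFibreTower.lean`, seat abc-iut-w5-d122; FACT-LIST F-3115): for THE certified special-fibre data `S` of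
a curve and ANY exhaustive sequence `N` of open characteristic normal finite-index subgroups of `Δ`, a `SpecialFibreTower Δ`
with levels `N` lying over `S`.

PROOF-ONLY file (abc-iut cell, layer L3; seat abc-iut-L3-t2 gen 4; no definition, no instance, no new named fact).  Sequel
of `SpecialFibreTowerOfCoverings.lean` (the Ex. 3.10 tower EXISTS over `π₁^temp(𝒢)` with fibres the covering
semi-graphs of anabelioids of the levels) and of `TemperedSpecialFibreTowerStatementPrincipal.lean` (principal
certificates with PROFINITE `Δ`, one-vertex fibres).  Here the NON-DEGENERATE case:

* `SpecialFibreTower.exists_of_continuousMulEquiv` — a special-fibre tower with admissible kernels `1` over `Δ'` pulls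
  back along any `Δ ≃ₜ* Δ'` to one over `Δ` with the corresponding levels (same fibres and charts);
* `exists_specialFibreOrigin_ex310TowerStatement_selfModel` — for EVERY `𝒢` satisfying the hypotheses of Thm. 3.7 and
  strictly coherent (e.g. finite coherent: `…_of_finite`), every chart `c`, and every algebraically closed `K`: the
  special-fibre SELF-MODEL `Π = Δ := π₁^temp(𝒢)` (`G_K = 1`; seat abc-iut-w4-d098's construction) with special-fibre
  data `(𝒢, c, id)` and the PRINCIPAL origin certifying exactly this pair satisfies `Ex310TowerStatement` — by
  `SpecialFibreTower.exists_of_coverings`: the tower's fibres are the covering semi-graphs of anabelioids `𝒢_{N_i}`,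
  its charts their tempered fundamental groups, its admissible quotients the étale identifications of Prop. 3.6 (v).

HONEST LIMITS: `G_K = 1` at the certificate (algebraically closed base) and `Δ := π₁^temp(𝒢)` BY DEFINITION (the
self-model identifies the geometric tempered fundamental group of the "curve" with that of its special fibre — for a
genuine curve the admissible quotient `Δ^temp_X ↠ π₁^temp(𝒢^c)` has a huge kernel); the fibres are the COMBINATORIAL
coverings of `𝒢`.  So this is the instance form of F-3115 at the richest principal certificate the tree can build, not
the intended certificate; the universal closure is neither claimed nor refuted.  No side is taken on [IUTchIII] Cor. 3.12.
-/

noncomputable section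

open CategoryTheory Topology

namespace Literature.AnabelianGeometry.SemiGraphs

open Literature.AlgebraicGeometry.Frobenioids (IsSlimGroup IsConnectedObj)
open ProfiniteSemiGraph

universe u

/-! ### Small facts (private) -/

/-- Open subgroups of slim groups are slim. [cite: MochizukiSemiAnbd2006, §0 p.6] -/
private theorem isSlimGroup_subgroup {G : Type u} [Group G] [TopologicalSpace G] [ContinuousMul G]
    (hG : IsSlimGroup G) (H : Subgroup G) (hH : IsOpen (H : Set G)) : IsSlimGroup H := by
  refine ⟨fun U hU => ?_⟩
  have hUo : IsOpen ((U.map H.subtype : Subgroup G) : Set G) := by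
    have : ((U.map H.subtype : Subgroup G) : Set G) = Subtype.val '' (U : Set H) := by
      ext x; simp
    rw [this]
    exact hH.isOpenMap_subtype_val _ hU
  have hc := hG.centralizer_eq_bot _ hUo
  refine (Subgroup.eq_bot_iff_forall _).mpr fun c hc' => ?_
  have hcG : (c : G) ∈ Subgroup.centralizer ((U.map H.subtype : Subgroup G) : Set G) := by
    rw [Subgroup.mem_centralizer_iff]
    rintro _ ⟨u, hu, rfl⟩
    exact congrArg Subtype.val (Subgroup.mem_centralizer_iff.mp hc' u hu)
  rw [hc] at hcG
  exact Subtype.ext (Subgroup.mem_bot.mp hcG)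

/-- Over an algebraically closed field the absolute Galois group is trivial. [folklore] -/
private theorem subsingleton_absoluteGaloisGroup_of_isAlgClosed (K : Type u) [Field K] [IsAlgClosed K] :
    Subsingleton (Field.absoluteGaloisGroup K) := by
  refine ⟨fun σ τ => AlgEquiv.ext fun x => ?_⟩
  obtain ⟨k, rfl⟩ :=
    (IsAlgClosed.algebraMap_bijective_of_isIntegral (k := K) (K := AlgebraicClosure K)).2 x
  rw [AlgEquiv.commutes, AlgEquiv.commutes]

/-- Exhaustive characteristic families of open normal finite-index subgroups are transported along isomorphisms of
topological groups (image family). [cite: MochizukiSemiAnbd2006, Ex 3.10 p.44] -/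
private theorem charLevels_map' {A B : Type u} [Group A] [TopologicalSpace A] [Group B] [TopologicalSpace B]
    (e : A ≃ₜ* B) (M : ℕ → Subgroup A) (hanti : Antitone M) (hopen : ∀ i, IsOpen (M i : Set A))
    (hchar : ∀ (i) (φ : A ≃ₜ* A), (M i).map φ.toMulEquiv.toMonoidHom = M i) (hnormal : ∀ i, (M i).Normal)
    (hfi : ∀ i, (M i).FiniteIndex) (hexh : ∀ g : A, (∀ i, g ∈ M i) → g = 1) :
    Antitone (fun i => (M i).map e.toMulEquiv.toMonoidHom) ∧
      (∀ i, IsOpen (((M i).map e.toMulEquiv.toMonoidHom : Subgroup B) : Set B)) ∧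
      (∀ (i) (φ : B ≃ₜ* B), ((M i).map e.toMulEquiv.toMonoidHom).map φ.toMulEquiv.toMonoidHom =
        (M i).map e.toMulEquiv.toMonoidHom) ∧
      (∀ i, ((M i).map e.toMulEquiv.toMonoidHom).Normal) ∧
      (∀ i, ((M i).map e.toMulEquiv.toMonoidHom).FiniteIndex) ∧
      ∀ g : B, (∀ i, g ∈ (M i).map e.toMulEquiv.toMonoidHom) → g = 1 := by
  refine ⟨fun i j hij => Subgroup.map_mono (hanti hij), fun i => ?_, fun i φ => ?_, fun i => ?_, fun i => ?_,
    fun g hg => ?_⟩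
  · rw [Subgroup.coe_map]
    exact e.toHomeomorph.isOpenMap _ (hopen i)
  · let ψ : A ≃ₜ* A := e.trans (φ.trans e.symm)
    have hcomp : e.toMulEquiv.toMonoidHom.comp ψ.toMulEquiv.toMonoidHom =
        φ.toMulEquiv.toMonoidHom.comp e.toMulEquiv.toMonoidHom :=
      MonoidHom.ext fun a => e.apply_symm_apply (φ (e a))
    calc ((M i).map e.toMulEquiv.toMonoidHom).map φ.toMulEquiv.toMonoidHom
        = (M i).map (φ.toMulEquiv.toMonoidHom.comp e.toMulEquiv.toMonoidHom) := Subgroup.map_map _ _ _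
      _ = (M i).map (e.toMulEquiv.toMonoidHom.comp ψ.toMulEquiv.toMonoidHom) := by rw [hcomp]
      _ = ((M i).map ψ.toMulEquiv.toMonoidHom).map e.toMulEquiv.toMonoidHom := (Subgroup.map_map _ _ _).symm
      _ = (M i).map e.toMulEquiv.toMonoidHom := by rw [hchar i ψ]
  · exact (hnormal i).map _ e.surjective
  · have hidx : ((M i).map e.toMulEquiv.toMonoidHom).index = (M i).index :=
      Subgroup.index_map_of_bijective (f := e.toMulEquiv.toMonoidHom) e.bijective (M i)
    exact ⟨by rw [hidx]; exact (hfi i).index_ne_zero⟩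
  · have h' : e.symm g = 1 := hexh (e.symm g) fun i => by
      obtain ⟨x, hx, hxg⟩ := hg i
      have : e.symm g = x := by rw [← hxg]; exact e.symm_apply_apply x
      rw [this]; exact hx
    simpa using congrArg e h'

/-! ### Pull-back of a tower with admissible kernels `1` along an isomorphism of topological groups -/

namespace SpecialFibreTower

/-- **Transport**: a special-fibre tower over `Δ'` with admissible kernels `1` and levels the images of a given family
`N` under an isomorphism `e : Δ ≃ₜ* Δ'` pulls back to a special-fibre tower over `Δ` with levels `N`, the SAME fibres
and charts, admissible quotients precomposed with `e`, admissible kernels `1`. [cite: MochizukiSemiAnbd2006, Ex 3.10 p.44] -/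
theorem exists_of_continuousMulEquiv {Δ Δ' : Type u} [Group Δ] [TopologicalSpace Δ] [Group Δ']
    [TopologicalSpace Δ'] (e : Δ ≃ₜ* Δ') (N : ℕ → Subgroup Δ) (hanti : Antitone N)
    (hopen : ∀ i, IsOpen (N i : Set Δ))
    (hchar : ∀ (i) (φ : Δ ≃ₜ* Δ), (N i).map φ.toMulEquiv.toMonoidHom = N i) (hnormal : ∀ i, (N i).Normal)
    (hfi : ∀ i, (N i).FiniteIndex) (hexh : ∀ g : Δ, (∀ i, g ∈ N i) → g = 1) (T' : SpecialFibreTower Δ')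
    (hN' : ∀ i, T'.N i = (N i).map e.toMulEquiv.toMonoidHom) (hadm' : ∀ i, T'.admKer i = ⊥) :
    ∃ T : SpecialFibreTower Δ, T.N = N ∧ (∀ i, T.admKer i = ⊥) ∧ (∀ i, T.Gc i = T'.Gc i) := by
  classical
  -- the isomorphisms `N_i ⥲ N'_i := e(N_i)`
  have hmem : ∀ i (x : N i), e x ∈ T'.N i := fun i x => by
    rw [hN' i]; exact Subgroup.mem_map_of_mem _ x.2
  have hmem' : ∀ i (y : Δ'), y ∈ T'.N i → e.symm y ∈ N i := fun i y hy => by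
    rw [hN' i] at hy
    obtain ⟨x, hx, hxy⟩ := hy
    have : e.symm y = x := by rw [← hxy]; exact e.symm_apply_apply x
    rw [this]; exact hx
  let eN : ∀ i, N i →ₜ* T'.N i := fun i =>
    { toFun := fun x => ⟨e x, hmem i x⟩
      map_one' := Subtype.ext (by
        change e ((1 : N i) : Δ) = ((1 : T'.N i) : Δ')
        rw [Subgroup.coe_one, Subgroup.coe_one, map_one])
      map_mul' := fun x y => Subtype.ext (by
        change e ((x * y : N i) : Δ) = e (x : Δ) * e (y : Δ)
        rw [Subgroup.coe_mul, map_mul])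
      continuous_toFun := (e.continuous.comp continuous_subtype_val).subtype_mk _ }
  have heN_surj : ∀ i, Function.Surjective (eN i) := fun i y =>
    ⟨⟨e.symm y, hmem' i y.1 y.2⟩, Subtype.ext (e.apply_symm_apply y)⟩
  have heN_inj : ∀ i, Function.Injective (eN i) := fun i x y hxy =>
    Subtype.ext (e.injective (congrArg Subtype.val hxy))
  have heN_open : ∀ i, IsOpenMap (eN i) := fun i => by
    let h : N i ≃ₜ T'.N i :=
      { toFun := eN i
        invFun := fun y => ⟨e.symm y, hmem' i y.1 y.2⟩
        left_inv := fun x => Subtype.ext (e.symm_apply_apply x)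
        right_inv := fun y => Subtype.ext (e.apply_symm_apply y)
        continuous_toFun := (eN i).continuous
        continuous_invFun := (e.symm.continuous.comp continuous_subtype_val).subtype_mk _ }
    exact h.isOpenMap
  have hadm_inj : ∀ i, Function.Injective (T'.adm i) := fun i => by
    have h := T'.ker_adm i
    rw [hadm' i, Subgroup.bot_subgroupOf] at h
    exact (MonoidHom.ker_eq_bot_iff (T'.adm i).toMonoidHom).mp h
  refine ⟨{ N := N
            N_antitone := hanti
            isOpen_N := hopen
            N_char := hchar
            N_normal := hnormal
            N_finiteIndex := hfi
            N_exhaustive := hexh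
            Gc := T'.Gc
            hyp := T'.hyp
            chart := T'.chart
            admKer := fun _ => ⊥
            admKer_le := fun _ => bot_le
            admKer_normal := fun _ => inferInstance
            admKer_antitone := fun _ _ _ => le_rfl
            adm := fun i => (T'.adm i).comp (eN i)
            adm_surjective := fun i => (T'.adm_surjective i).comp (heN_surj i)
            isOpenMap_adm := fun i => (T'.isOpenMap_adm i).comp (heN_open i)
            ker_adm := fun i => by
              rw [Subgroup.bot_subgroupOf]
              exact (MonoidHom.ker_eq_bot_iff _).mpr ((hadm_inj i).comp (heN_inj i))
            faithful := fun i g hg => ?_ }, rfl, fun _ => rfl, fun _ => rfl⟩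
  -- faithfulness pulls back: `e g` acts trivially modulo `admKer' = 1` on `N'_i = e(N_i)`, so `e g ∈ e(N_i)`
  have hg' : ∀ n' ∈ T'.N i, e g * n' * (e g)⁻¹ * n'⁻¹ ∈ T'.admKer i := by
    intro n' hn'
    have hn : e.symm n' ∈ N i := hmem' i n' hn'
    have h := hg (e.symm n') hn
    rw [Subgroup.mem_bot] at h
    rw [hadm' i, Subgroup.mem_bot]
    have : e (g * e.symm n' * g⁻¹ * (e.symm n')⁻¹) = e g * n' * (e g)⁻¹ * n'⁻¹ := by
      rw [map_mul, map_mul, map_mul, map_inv, map_inv, e.apply_symm_apply]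
    rw [← this, h, map_one]
  have hmemN' : e g ∈ T'.N i := T'.faithful i (e g) hg'
  simpa using hmem' i (e g) hmemN'

end SpecialFibreTower

/-! ### `Ex310TowerStatement` at the special-fibre self-model of a strictly coherent Thm-3.7 semi-graph of anabelioids -/

/-- **`Ex310TowerStatement` HOLDS at the principal certificate of the special-fibre SELF-MODEL of every strictly
coherent Thm-3.7 semi-graph of anabelioids `𝒢` with chart `c`** (over any algebraically closed `K`, `G_K = 1`):
`Π = Δ := π₁^temp(𝒢)`, special-fibre data `(𝒢, c, id)`, origin certifying exactly this pair — and for every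
certified pair and EVERY exhaustive sequence of open characteristic normal finite-index subgroups of `Δ` the tower
EXISTS with fibres the covering semi-graphs of anabelioids of the levels (`SpecialFibreTower.exists_of_coverings`,
pulled back along `Δ ≅ π₁^temp(𝒢)`) and lies over the certified data (admissible kernels `1`).
[cite: MochizukiSemiAnbd2006, Ex 3.10 p.44] -/
theorem exists_specialFibreOrigin_ex310TowerStatement_selfModel (K : Type u) [Field K] [IsAlgClosed K]
    (𝒢 : ProfiniteSemiGraph.{u}) (h37 : 𝒢.Thm37Hypotheses) (hsc : 𝒢.IsStrictlyCoherent)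
    (c : TemperedPiChart 𝒢) :
    ∃ (D : TemperedArithmeticGroup K) (S : SpecialFibreData D) (Ω : SpecialFibreOrigin K),
      Ω.IsSpecialFibreOf D S ∧ Ω.IsOfGeometricOrigin D ∧ S.Gc = 𝒢 ∧ Nonempty (D.delta ≃ₜ* c.G) ∧
        (∀ (D' : TemperedArithmeticGroup K) (S' : SpecialFibreData D'), Ω.IsSpecialFibreOf D' S' ↔
          (⟨D', S'⟩ : Σ A : TemperedArithmeticGroup K, SpecialFibreData A) = ⟨D, S⟩) ∧
        Ex310TowerStatement Ω := by
  classical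
  haveI : Subsingleton (Field.absoluteGaloisGroup K) := subsingleton_absoluteGaloisGroup_of_isAlgClosed K
  haveI : SecondCountableTopology c.G := c.secondCountableTopology
  have h36 : 𝒢.Prop36Hypotheses := h37.toProp36Hypotheses
  have hslim : IsSlimGroup c.G := temperedPiSlim_holds 𝒢 h36 c
  -- the trivial augmentation `Π = π₁^temp(𝒢) → G_K = 1`
  let aug : c.G →ₜ* Field.absoluteGaloisGroup K := { toMonoidHom := 1, continuous_toFun := continuous_const }
  have hker : aug.toMonoidHom.ker = ⊤ := by
    ext g; simp [aug]
  have hΔtemp : IsTempered (aug.toMonoidHom.ker : Subgroup c.G) := by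
    rw [hker]; exact c.isTempered.subgroup_of_isClosed ⊤ (by rw [Subgroup.coe_top]; exact isClosed_univ)
  have hΔslim : IsSlimGroup (aug.toMonoidHom.ker : Subgroup c.G) := by
    rw [hker]; exact isSlimGroup_subgroup hslim ⊤ (by rw [Subgroup.coe_top]; exact isOpen_univ)
  let D : TemperedArithmeticGroup K :=
    { Pi := c.G
      isTempered := c.isTempered
      aug := aug
      aug_surjective := fun g => ⟨1, Subsingleton.elim _ _⟩
      isTempered_ker := hΔtemp
      isSlimGroup := hslim
      isSlimGroup_ker := hΔslim
      secondCountableTopology := c.secondCountableTopology }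
  have hmemΔ : ∀ g : c.G, g ∈ D.delta := fun g => by
    change g ∈ aug.toMonoidHom.ker
    rw [hker]; exact Subgroup.mem_top g
  let e : D.delta ≃ₜ* c.G :=
    { toFun := fun x => x.1
      invFun := fun g => ⟨g, hmemΔ g⟩
      left_inv := fun _ => rfl
      right_inv := fun _ => rfl
      map_mul' := fun _ _ => rfl
      continuous_toFun := continuous_subtype_val
      continuous_invFun := continuous_id.subtype_mk _ }
  let adm : D.delta →ₜ* c.G := { toMonoidHom := D.delta.subtype, continuous_toFun := continuous_subtype_val }
  let S : SpecialFibreData D :=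
    { Gc := 𝒢, hyp := h37, chart := c, admissible := adm, admissible_surjective := fun g => ⟨⟨g, hmemΔ g⟩, rfl⟩ }
  let Ω : SpecialFibreOrigin K :=
    { IsOfGeometricOrigin := fun A => A = D
      IsTateOrigin := fun _ => False
      isOfGeometricOrigin_of_isTateOrigin := fun _ h => h.elim
      IsSpecialFibreOf := fun D' S' => (⟨D', S'⟩ : Σ A : TemperedArithmeticGroup K, SpecialFibreData A) = ⟨D, S⟩
      isOfGeometricOrigin_of_isSpecialFibreOf := fun D' S' h => congrArg Sigma.fst h }
  refine ⟨D, S, Ω, rfl, rfl, rfl, ⟨e⟩, fun _ _ => Iff.rfl, ?_⟩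
  -- the origin statement: reduce to `D' = D`, transport the levels to `π₁^temp(𝒢)`, build the tower of coverings, pull back
  intro D' S' hS' N hanti hopen hchar hnormal hfi hexh
  obtain rfl : D' = D := congrArg Sigma.fst hS'
  obtain ⟨hanti', hopen', hchar', hnormal', hfi', hexh'⟩ := charLevels_map' e N hanti hopen hchar hnormal hfi hexh
  obtain ⟨T', hTN', hadm', -⟩ := SpecialFibreTower.exists_of_coverings h37 hsc c
    (fun i => (N i).map e.toMulEquiv.toMonoidHom) hanti' hopen' hchar' hnormal' hfi' hexh'
  obtain ⟨T, hTN, hadm, -⟩ := SpecialFibreTower.exists_of_continuousMulEquiv e N hanti hopen hchar hnormal hfi hexh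
    T' (fun i => by rw [hTN']) hadm'
  exact ⟨T, hTN, fun i => by rw [hadm i]; exact bot_le⟩

/-- **The same over a FINITE coherent Thm-3.7 semi-graph of anabelioids with chart** (strict coherence automatic) —
the regime of special fibres of curves. [cite: MochizukiSemiAnbd2006, Ex 3.10 p.44] -/
theorem exists_specialFibreOrigin_ex310TowerStatement_selfModel_of_finite (K : Type u) [Field K] [IsAlgClosed K]
    (𝒢 : ProfiniteSemiGraph.{u}) [Finite 𝒢.graph.Vertex] [Finite 𝒢.graph.Edge] (h37 : 𝒢.Thm37Hypotheses)
    (hcoh : 𝒢.IsCoherent) (c : TemperedPiChart 𝒢) :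
    ∃ (D : TemperedArithmeticGroup K) (S : SpecialFibreData D) (Ω : SpecialFibreOrigin K),
      Ω.IsSpecialFibreOf D S ∧ Ω.IsOfGeometricOrigin D ∧ S.Gc = 𝒢 ∧ Nonempty (D.delta ≃ₜ* c.G) ∧
        Ex310TowerStatement Ω := by
  obtain ⟨D, S, Ω, h1, h2, h3, h4, -, h5⟩ := exists_specialFibreOrigin_ex310TowerStatement_selfModel K 𝒢 h37
    (isStrictlyCoherent_of_finite ⟨‹_›, ‹_›⟩ hcoh) c
  exact ⟨D, S, Ω, h1, h2, h3, h4, h5⟩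

end Literature.AnabelianGeometry.SemiGraphs

end
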